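import Literature.Computability.AlgebraicComplexity.MS2001GenericCircuitForm
import Mathlib.LinearAlgebra.LinearIndependent.Basic
import Mathlib.Algebra.CharP.Basic
import Mathlib.Algebra.Field.ZMod
import Mathlib.FieldTheory.IsAlgClosed.AlgebraicClosure
import Mathlib.Data.Fintype.Perm
import Mathlib.Data.Nat.Factorial.Basic
import HarnessLib

/-!
# GCT I §6: the automorphisms `Q` of the generic circuit, `Q`-invariant forms, and Prop. 6.2 —
# PROOFS, and the characteristic-`p` erratum

Topic `Computability/AlgebraicComplexity`. Cell `val-lit`, row MS2001-A (K. Mulmuley, M. Sohoni,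
*Geometric complexity theory I*, SIAM J. Comput. 31 (2001) 496–526), §6, typed from the AUTHORS'
VERSION (AV; text of record `HOME/bip/texts/MS2001-authorversion/`, locators «AV p.N, all.txt
Lnnnn»). Companion of `MS2001GenericCircuitForm.lean` (the form `H(Y) = genericCircuitForm F k m`
on the variables `Y = MS2001GenericCircuit.Var k m`). The row «Prop 6.2» of `HOME/bip/CHECK-t01.md`
was SKIPPED at typing time; this file types and PROVES it — and records that, AS PRINTED (over an
algebraically closed field of arbitrary characteristic, the standing assumption of §6, AV p.28
L2000–2001), it is FALSE in characteristic `p ≤ m`. Theorems and bodied definitions only: no named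
facts, no instances, no `sorry`.

## The source (AV p.29, all.txt L2074–2121)

> "The form `H(Y)` turns out to be good like the determinant function because it has a large
> nontrivial stabilizer that in a sense characterizes it. Indeed, any automorphism of the generic
> circuit that fixes the nodes in the input level `k` gives rise to an element of `SL_l(F)` that
> stabilizes `H(Y)`. Quite likely, the stabilizer of `H(Y)` is precisely the discrete group `Q` of
> such automorphisms. It contains `k` copies of the symmetric group `S_m`, where `k` is the depth
> of the generic circuit and `m` is its width. […] Let `M(Y)` be the set of monomials over `Y`
> with total degree equal to that of `H(Y)` […]. It has a natural `Q`-action induced by that on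
> the generic circuit. Order the monomials in `M(Y)` lexicographically. We call a monomial
> maximal if it is the largest monomial in its `Q`-orbit. Let `M_m(Y) ⊆ M(Y)` be the subset of
> maximal monomials. Given any monomial `α`, let `α̂` denote it[s] symmetrization `∑_{σ∈Q} σ(α)`.
> Let `V` be the space of homogeneous forms in `Y` of total degree equal to that of `H(Y)`. The
> following is easy to prove.
> **Proposition 6.2** The set of forms `α̂`, `α ∈ M_m(Y)`, is a basis of the space `V^Q` of
> `Q`-invariants in `V`.

## Contents

* §1 `MS2001GenericCircuit.CircuitAut k m = (Fin (k-1) → Equiv.Perm (Fin m))` — the group `Q` of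
  automorphisms of the generic circuit fixing the input nodes: one permutation of the `m` nodes
  of each of the `k - 1` internal levels (the root and the inputs are fixed; the levels are
  complete bipartite, so these are all the automorphisms); its action `actVar` / `toPerm` on the
  variables `Y` (a node permutation moves `y_u ↦ y_u` (inputs fixed), `y^u_{v,w} ↦
  y^{πu}_{πv,πw}` with the permutations of the respective levels), and the PROOF that `Q`
  stabilizes `H(Y)`: `rename_toPerm_genericCircuitForm` ("any automorphism of the generic circuit
  that fixes the nodes in the input level `k` … stabilizes `H(Y)`", L2076–2079; typed as
  invariance under the induced permutation of variables — see "deviations" for the `SL_l` clause).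
* §2 For a finite group `G` acting on variables `X` through `φ : G →* Equiv.Perm X` (general
  form of the print's `Q`-action on `M(Y)`): the action `monAct` on monomials, orbits
  `orbitFs`, orbit sums `orbitSum`, the symmetrization `symmetrize φ p = ∑_{g} g · p` (the
  print's `α̂` for `p` a monomial), stabilizer counts `stabCard`, the space `invariantForms φ D`
  of `G`-invariant forms of degree `D` (the print's `V^Q`), transversals of the orbits on
  degree-`D` monomials (`IsTransversal`; the print's `M_m(Y)` = lexicographically maximal
  monomials is one), and the PROOFS: orbit sums of a transversal are a BASIS of the invariant
  forms over every field (`linearIndependent_orbitSum`, `span_orbitSum_eq`), `α̂ = |Stab α| · (orbit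
  sum of α)` (`symmetrize_monomial`), hence the symmetrizations are a basis as soon as the
  stabilizer orders are nonzero in `F` (`symmetrize_basis_of_ne_zero`); a transversal exists
  (`exists_isTransversal`).
* §3 **Prop. 6.2** for `H(Y)`: `MS2001_prop_6_2` — over a field of characteristic ZERO, for every
  depth `k ≥ 1`, width `m` and every transversal `Λ` of the `Q`-orbits on the monomials of degree
  `deg H(Y) = 2^{k+1} - 1`, the symmetrizations `α̂`, `α ∈ Λ`, are linearly independent and span
  `V^Q`; `MS2001_prop_6_2_orbitSum` — the same with ORBIT SUMS in place of symmetrizations, over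
  EVERY field (the characteristic-free form); `genericCircuitForm_mem_invariantForms` — `H(Y) ∈ V^Q`.
* §5 `MS2001_genericCircuitForm_not_unique_invariant` — "Unlike the determinant (cf. Proposition
  4.2), `H(Y)` is not a unique form stabilized by `Q`" (AV p.29 L2116–2117): `V^Q` contains a form
  (the `Q`-fixed monomial `y_u^D`) that is not a multiple of `H(Y)`.
* §4 ERRATUM (ours, kernel-checked): `MS2001_prop_6_2_false_of_charP` — over any field of
  characteristic `p` with `p ≤ m` and `k ≥ 2`, for EVERY transversal `Λ` the family `(α̂)_{α ∈ Λ}`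
  is NOT linearly independent (the monomial `y_u^D` of an input variable is fixed by `Q`, so
  `α̂ = |Q| · α = (m!)^{k-1} · α = 0`, and it lies in every transversal); in particular Prop. 6.2
  fails as printed over the algebraically closed field `\overline{F_p}`
  (`MS2001_prop_6_2_false_algebraicClosure`). The characteristic-free statement is the orbit-sum
  form of §3. This matters for §7, which proposes `F_p`-versions of the programme (Conj. 7.10,
  7.11, Prop. 7.9).

## Deviations (disclosed)

* `Q` AS LEVEL PERMUTATIONS. Print: "the discrete group `Q` of such automorphisms [of the generic
  circuit that fix the nodes in the input level]". The generic circuit of p.28 is the complete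
  leveled graph (every node of level `i < k` joined to every node of level `i + 1`), so an
  automorphism fixing the inputs (and necessarily the unique root) is exactly a family of
  permutations of the internal levels `1, …, k - 1`: `Q ≃ (S_m)^{k-1}` (the print's "`k` copies
  of `S_m`" counts one level more). Typed directly as `Fin (k-1) → Equiv.Perm (Fin m)`, indexed by
  height as in the companion file (`levelPerm π h` = the permutation of the nodes at height `h`,
  identity at height `0` = inputs).
* "gives rise to an element of `SL_l(F)` that stabilizes `H(Y)`": the induced permutation matrix
  of `Y` has determinant `±1`; on `P(V)` it acts like an element of `SL_l` after a scalar. Typed: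
  the permutation of variables fixes `H(Y)` (`rename_toPerm_genericCircuitForm`); the `SL_l`
  clause and "Quite likely, the stabilizer of `H(Y)` is precisely `Q`" (a conjecture) are NOT typed.
* MAXIMAL MONOMIALS. Print: `M_m(Y)` = the lexicographically largest monomial of each `Q`-orbit.
  Typed for EVERY transversal `Λ` of the `Q`-orbits on `M(Y)` (`IsTransversal`): the choice of
  representatives is immaterial to the statement, the lexicographic one is an instance, and
  `exists_isTransversal` records that transversals exist.
* "is a basis of `V^Q`" is typed as the conjunction (linear independence of the family) ∧ (its
  span equals the submodule `V^Q`).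
* CHARACTERISTIC. §6 works "over an algebraically closed field `F`" (AV p.28 L2000) of arbitrary
  characteristic (§4, and the `F_p`-variants of §7). `MS2001_prop_6_2` carries `CharZero F`
  (sharper: all stabilizer orders nonzero in `F`, `symmetrize_basis_of_ne_zero`); §4 proves the
  statement false for `char F = p ≤ m`, `k ≥ 2`. No fact is minted for the false reading.

Honest framing: literature typing (invariant theory of a finite permutation group on monomials);
nothing here bears on any separation (`VP ≠ VNP` is NOT proved).

## References

* [MulmuleySohoniSIAM2001] K. Mulmuley, M. Sohoni, *Geometric complexity theory I*, SIAM J.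
  Comput. 31 (2001) 496–526, §6 (AV p.29, all.txt L2074–2121), Prop. 6.2 (L2112–2114).
-/

noncomputable section

open MvPolynomial

namespace Literature.Computability.AlgebraicComplexity

universe u v w

namespace MS2001GenericCircuit

/-! ## §1. The automorphism group `Q` of the generic circuit and its action on `Y` -/

/-- **The group `Q`** of automorphisms of the generic circuit of depth `k` and width `m` fixing
the input nodes (AV p.29 L2076–2081): a permutation of the `m` nodes of each internal level,
indexed by height − 1 ∈ `Fin (k - 1)` (the root, alone on level `0`, and the inputs are fixed).
A group and a finite type through the `Pi` instances. [cite: MulmuleySohoniSIAM2001, §6 (AV p.29, all.txt L2076–2081)] -/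
abbrev CircuitAut (k m : ℕ) : Type := Fin (k - 1) → Equiv.Perm (Fin m)

section Aut

variable {k m : ℕ}

/-- The permutation of the nodes at height `h` induced by `π ∈ Q`: the identity at height `0`
(the inputs are fixed) and at junk heights `≥ k`, `π_{h-1}` at the internal heights
`1 ≤ h ≤ k - 1`. [cite: MulmuleySohoniSIAM2001, §6 (AV p.29, all.txt L2076–2081)] -/
def levelPerm (π : CircuitAut k m) (h : ℕ) : Equiv.Perm (Fin m) :=
  if hh : 1 ≤ h ∧ h - 1 < k - 1 then π ⟨h - 1, hh.2⟩ else 1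

/-- Inputs are fixed. [cite: MulmuleySohoniSIAM2001, §6 (AV p.29, all.txt L2076–2077)] -/
@[simp]
theorem levelPerm_zero (π : CircuitAut k m) : levelPerm π 0 = 1 := by
  simp [levelPerm]

/-- At an internal height `j + 1 ≤ k - 1`, `π` acts by its component `π_j`.
[cite: MulmuleySohoniSIAM2001, §6 (AV p.29, all.txt L2076–2081)] -/
theorem levelPerm_succ (π : CircuitAut k m) {j : ℕ} (hj : j < k - 1) :
    levelPerm π (j + 1) = π ⟨j, hj⟩ := by
  simp [levelPerm, hj]

/-- `levelPerm` is multiplicative. [folklore] -/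
private theorem levelPerm_mul (π π' : CircuitAut k m) (h : ℕ) :
    levelPerm (π * π') h = levelPerm π h * levelPerm π' h := by
  unfold levelPerm
  split_ifs with hh
  · rfl
  · exact (mul_one 1).symm

/-- `levelPerm` of the identity. [folklore] -/
private theorem levelPerm_one (h : ℕ) : levelPerm (1 : CircuitAut k m) h = 1 := by
  unfold levelPerm
  split_ifs <;> rfl

/-- **The action of `Q` on the variables `Y`** (AV p.29 L2076–2079, "induced by that on the
generic circuit"): `y_u ↦ y_u` for an input node `u`; `y^{root}_{v,w} ↦ y^{root}_{πv, πw}` with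
the permutation of the top internal level; `y^u_{v,w} ↦ y^{πu}_{πv,πw}` with the permutations of
the levels of `u` and of `v, w`. [cite: MulmuleySohoniSIAM2001, §6 (AV p.29, all.txt L2076–2079)] -/
def actVar (π : CircuitAut k m) : Var k m → Var k m
  | Sum.inl u => Sum.inl u
  | Sum.inr (Sum.inl (v, w)) => Sum.inr (Sum.inl (levelPerm π (k - 1) v, levelPerm π (k - 1) w))
  | Sum.inr (Sum.inr (j, u, v, w)) =>
    Sum.inr (Sum.inr (j, levelPerm π (j + 1) u, levelPerm π j v, levelPerm π j w))

/-- The action is multiplicative. [folklore] -/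
private theorem actVar_mul (π π' : CircuitAut k m) (x : Var k m) :
    actVar (π * π') x = actVar π (actVar π' x) := by
  rcases x with u | ⟨⟨v, w⟩ | ⟨j, u, v, w⟩⟩ <;> simp [actVar, levelPerm_mul]

/-- The identity acts trivially. [folklore] -/
private theorem actVar_one (x : Var k m) : actVar (1 : CircuitAut k m) x = x := by
  rcases x with u | ⟨⟨v, w⟩ | ⟨j, u, v, w⟩⟩ <;> simp [actVar, levelPerm_one]

variable (k m)

/-- **`Q → Sym(Y)`**: the action of `Q` on the variables as a homomorphism to the permutations of
`Y` (each `π` acts bijectively, with inverse the action of `π⁻¹`).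
[cite: MulmuleySohoniSIAM2001, §6 (AV p.29, all.txt L2076–2079)] -/
def toPerm : CircuitAut k m →* Equiv.Perm (Var k m) where
  toFun π :=
    { toFun := actVar π
      invFun := actVar π⁻¹
      left_inv := fun x => by rw [← actVar_mul, inv_mul_cancel, actVar_one]
      right_inv := fun x => by rw [← actVar_mul, mul_inv_cancel, actVar_one] }
  map_one' := Equiv.ext actVar_one
  map_mul' π π' := Equiv.ext (actVar_mul π π')

variable {k m}

/-- Unfolding `toPerm`. [cite: MulmuleySohoniSIAM2001, §6 (AV p.29, all.txt L2076–2079)] -/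
@[simp]
theorem toPerm_apply (π : CircuitAut k m) (x : Var k m) : toPerm k m π x = actVar π x := rfl

variable (F : Type u) [CommSemiring F]

/-- **`Q` permutes the node forms within each level**: renaming the variables by `π ∈ Q` sends the
form `h(u)` of the node `u` at height `j` to the form of the node `π u` at the same height.
[cite: MulmuleySohoniSIAM2001, §6 (AV p.29, all.txt L2076–2079)] -/
theorem rename_actVar_nodeVal (π : CircuitAut k m) : ∀ (j : ℕ), j ≤ k - 1 → ∀ u : Fin m,
    rename (actVar π) (nodeVal F k m j u) = nodeVal F k m j (levelPerm π j u)
  | 0, _, u => by simp [actVar]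
  | j + 1, hj, u => by
    have hj' : j < k - 1 := by omega
    have ih : ∀ v : Fin m, rename (actVar π) (nodeVal F k m j v) = nodeVal F k m j (levelPerm π j v) :=
      rename_actVar_nodeVal π j hj'.le
    rw [nodeVal_succ F k m hj', nodeVal_succ F k m hj', map_sum]
    simp only [map_sum, map_mul, rename_X, actVar, ih]
    refine Fintype.sum_equiv (levelPerm π j) _ _ fun v => ?_
    exact Fintype.sum_equiv (levelPerm π j) _ _ fun w => rfl

/-- **`Q` stabilizes `H(Y)`** (AV p.29 L2076–2079: "any automorphism of the generic circuit that
fixes the nodes in the input level `k` gives rise to an element […] that stabilizes `H(Y)`"):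
renaming the variables `Y` by the permutation induced by any `π ∈ Q` fixes the generic circuit
form. (The print's clause "an element of `SL_l(F)`" — the permutation matrix has determinant `±1`
and acts on `P(V)` as an element of `SL_l` up to a scalar — is not typed.)
[cite: MulmuleySohoniSIAM2001, §6 (AV p.29, all.txt L2076–2079)] -/
theorem rename_toPerm_genericCircuitForm (π : CircuitAut k m) :
    rename (toPerm k m π) (genericCircuitForm F k m) = genericCircuitForm F k m := by
  rw [show (⇑(toPerm k m π) : Var k m → Var k m) = actVar π from rfl, genericCircuitForm, map_sum]
  simp only [map_sum, map_mul, rename_X, actVar, rename_actVar_nodeVal F π (k - 1) le_rfl]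
  refine Fintype.sum_equiv (levelPerm π (k - 1)) _ _ fun v => ?_
  exact Fintype.sum_equiv (levelPerm π (k - 1)) _ _ fun w => rfl

end Aut

/-! ## §2. Invariant forms of a finite permutation group of the variables: orbit sums,
symmetrizations, transversals (general form of the `Q`-action on `M(Y)` and of `V^Q`) -/

section PermInvariants

variable {X : Type v} {G : Type w} [Group G] (φ : G →* Equiv.Perm X)

/-- The action of `g ∈ G` on monomials (exponent vectors) induced by the permutation `φ g` of the
variables ("a natural `Q`-action induced by that on the generic circuit", AV p.29 L2107–2108).
[cite: MulmuleySohoniSIAM2001, §6 (AV p.29, all.txt L2107–2108)] -/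
def monAct (g : G) (α : X →₀ ℕ) : X →₀ ℕ := Finsupp.mapDomain (φ g) α

/-- The identity acts trivially on monomials. [folklore] -/
private theorem monAct_one (α : X →₀ ℕ) : monAct φ 1 α = α := by
  simp [monAct, Finsupp.mapDomain_id]

/-- The action on monomials is multiplicative. [folklore] -/
private theorem monAct_mul (g h : G) (α : X →₀ ℕ) : monAct φ (g * h) α = monAct φ g (monAct φ h α) := by
  simp only [monAct, map_mul, Equiv.Perm.coe_mul, Finsupp.mapDomain_comp]

/-- `g⁻¹` undoes `g` on monomials. [folklore] -/
private theorem monAct_inv_monAct (g : G) (α : X →₀ ℕ) : monAct φ g⁻¹ (monAct φ g α) = α := by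
  rw [← monAct_mul, inv_mul_cancel, monAct_one]

/-- `g` undoes `g⁻¹` on monomials. [folklore] -/
private theorem monAct_monAct_inv (g : G) (α : X →₀ ℕ) : monAct φ g (monAct φ g⁻¹ α) = α := by
  rw [← monAct_mul, mul_inv_cancel, monAct_one]

/-- The action preserves the degree of monomials. [folklore] -/
private theorem degree_monAct (g : G) (α : X →₀ ℕ) : (monAct φ g α).degree = α.degree := by
  simp [monAct, Finsupp.degree_mapDomain]

/-- The action on monomials is the renaming action on the monomial basis. [folklore] -/
private theorem rename_monomial_eq {F : Type u} [CommSemiring F] (g : G) (α : X →₀ ℕ) (c : F) :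
    rename (φ g) (monomial α c) = monomial (monAct φ g α) c := by
  rw [monAct, rename_monomial]

/-- Coefficients under renaming: the coefficient of `g · α` in `g · p` is that of `α` in `p`.
[folklore] -/
private theorem coeff_monAct_rename {F : Type u} [CommSemiring F] (g : G) (α : X →₀ ℕ)
    (p : MvPolynomial X F) : coeff (monAct φ g α) (rename (φ g) p) = coeff α p := by
  rw [monAct, coeff_rename_mapDomain _ (φ g).injective]

variable [DecidableEq X] [Fintype G]

/-- **The `G`-orbit of a monomial**, as a finite set (the print's "`Q`-orbit" of a monomial,
AV p.29 L2109–2110). [cite: MulmuleySohoniSIAM2001, §6 (AV p.29, all.txt L2109–2110)] -/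
def orbitFs (α : X →₀ ℕ) : Finset (X →₀ ℕ) := Finset.univ.image fun g : G => monAct φ g α

/-- Membership in an orbit. [folklore] -/
private theorem mem_orbitFs {α β : X →₀ ℕ} : β ∈ orbitFs φ α ↔ ∃ g : G, monAct φ g α = β := by
  simp [orbitFs]

/-- A monomial lies in its own orbit. [folklore] -/
private theorem self_mem_orbitFs (α : X →₀ ℕ) : α ∈ orbitFs φ α :=
  (mem_orbitFs φ).2 ⟨1, monAct_one φ α⟩

/-- Orbits of orbit members coincide. [folklore] -/
private theorem orbitFs_eq_of_mem {α β : X →₀ ℕ} (h : β ∈ orbitFs φ α) : orbitFs φ β = orbitFs φ α := by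
  obtain ⟨g, rfl⟩ := (mem_orbitFs φ).1 h
  ext γ
  simp only [mem_orbitFs]
  constructor
  · rintro ⟨h, rfl⟩
    exact ⟨h * g, monAct_mul φ h g α⟩
  · rintro ⟨h, rfl⟩
    exact ⟨h * g⁻¹, by rw [← monAct_mul, mul_assoc, inv_mul_cancel, mul_one]⟩

/-- Orbit membership is symmetric. [folklore] -/
private theorem mem_orbitFs_comm {α β : X →₀ ℕ} (h : β ∈ orbitFs φ α) : α ∈ orbitFs φ β := by
  rw [orbitFs_eq_of_mem φ h]
  exact self_mem_orbitFs φ α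

/-- Members of an orbit have the same degree. [folklore] -/
private theorem degree_eq_of_mem_orbitFs {α β : X →₀ ℕ} (h : β ∈ orbitFs φ α) :
    β.degree = α.degree := by
  obtain ⟨g, rfl⟩ := (mem_orbitFs φ).1 h
  exact degree_monAct φ g α

/-- The orbit is stable under the action. [folklore] -/
private theorem monAct_mem_orbitFs {α β : X →₀ ℕ} (h : β ∈ orbitFs φ α) (g : G) :
    monAct φ g β ∈ orbitFs φ α := by
  obtain ⟨g', rfl⟩ := (mem_orbitFs φ).1 h
  exact (mem_orbitFs φ).2 ⟨g * g', monAct_mul φ g g' α⟩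

/-- **The number of elements of `G` fixing the monomial `α`** (the order of its stabilizer).
[cite: MulmuleySohoniSIAM2001, §6 (AV p.29, all.txt L2109–2111)] -/
def stabCard (α : X →₀ ℕ) : ℕ := (Finset.univ.filter fun g : G => monAct φ g α = α).card

/-- The stabilizer is nonempty (it contains `1`). [folklore] -/
private theorem stabCard_pos (α : X →₀ ℕ) : 0 < stabCard φ α :=
  Finset.card_pos.2 ⟨1, by simp [monAct_one]⟩

/-- A monomial fixed by all of `G` has stabilizer of order `|G|`. [folklore] -/
private theorem stabCard_eq_card_of_forall {α : X →₀ ℕ} (h : ∀ g : G, monAct φ g α = α) :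
    stabCard φ α = Fintype.card G := by
  rw [stabCard, Finset.filter_true_of_mem fun g _ => h g, Finset.card_univ]

/-- Coset counting: the elements of `G` sending `α` to a given member `β` of its orbit are as
many as those fixing `α`. [folklore] -/
private theorem card_filter_monAct_eq {α β : X →₀ ℕ} (hβ : β ∈ orbitFs φ α) :
    (Finset.univ.filter fun g : G => monAct φ g α = β).card = stabCard φ α := by
  classical
  obtain ⟨g₀, rfl⟩ := (mem_orbitFs φ).1 hβ
  rw [stabCard]
  have hmap : (Finset.univ.filter fun g : G => monAct φ g α = monAct φ g₀ α) =
      (Finset.univ.filter fun g : G => monAct φ g α = α).map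
        (Equiv.mulLeft g₀).toEmbedding := by
    ext g
    simp only [Finset.mem_filter, Finset.mem_univ, true_and, Finset.mem_map_equiv]
    constructor
    · intro hg
      have : monAct φ (g₀⁻¹ * g) α = α := by
        rw [monAct_mul, hg, monAct_inv_monAct]
      simpa [Equiv.mulLeft_symm_apply] using this
    · intro hg
      have hg' : monAct φ (g₀⁻¹ * g) α = α := by simpa [Equiv.mulLeft_symm_apply] using hg
      have : monAct φ g₀ (monAct φ (g₀⁻¹ * g) α) = monAct φ g₀ α := by rw [hg']
      rwa [← monAct_mul, ← mul_assoc, mul_inv_cancel, one_mul] at this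
  rw [hmap, Finset.card_map]

variable (F : Type u) [Field F]

/-- **The orbit sum** of a monomial `α`: the sum of the distinct monomials of its `G`-orbit (the
characteristic-free replacement of the print's symmetrization `α̂`).
[cite: MulmuleySohoniSIAM2001, §6 (AV p.29, all.txt L2109–2111)] -/
def orbitSum (α : X →₀ ℕ) : MvPolynomial X F := ∑ β ∈ orbitFs φ α, monomial β (1 : F)

/-- **The symmetrization** `p̂ = ∑_{σ ∈ G} σ(p)` (AV p.29 L2110–2111, for `p` a monomial `α`:
"let `α̂` denote it[s] symmetrization `∑_{σ∈Q} σ(α)`").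
[cite: MulmuleySohoniSIAM2001, §6 (AV p.29, all.txt L2110–2111)] -/
def symmetrize (p : MvPolynomial X F) : MvPolynomial X F := ∑ g : G, rename (φ g) p

/-- `G`-invariance of a polynomial under the renaming action.
[cite: MulmuleySohoniSIAM2001, §6 (AV p.29, all.txt L2112–2114)] -/
def IsInvariant (p : MvPolynomial X F) : Prop := ∀ g : G, rename (φ g) p = p

/-- **The space `V^G` of `G`-invariant forms of degree `D`** (the print's `V^Q`, `V` = forms in `Y`
of degree `deg H(Y)`, AV p.29 L2111–2114), as a submodule of the polynomial ring.
[cite: MulmuleySohoniSIAM2001, §6 (AV p.29, all.txt L2111–2114)] -/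
def invariantForms (D : ℕ) : Submodule F (MvPolynomial X F) where
  carrier := {p | p.IsHomogeneous D ∧ IsInvariant φ F p}
  zero_mem' := ⟨isHomogeneous_zero X F D, fun g => map_zero _⟩
  add_mem' := fun {p q} hp hq => ⟨hp.1.add hq.1, fun g => by rw [map_add, hp.2 g, hq.2 g]⟩
  smul_mem' := fun c {p} hp =>
    ⟨(homogeneousSubmodule X F D).smul_mem c hp.1, fun g => by
      rw [smul_eq_C_mul, map_mul, rename_C, hp.2 g]⟩

omit [DecidableEq X] [Fintype G] in
/-- Membership in `V^G`, unfolded. [cite: MulmuleySohoniSIAM2001, §6 (AV p.29, all.txt L2111–2114)] -/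
theorem mem_invariantForms {D : ℕ} {p : MvPolynomial X F} :
    p ∈ invariantForms φ F D ↔ p.IsHomogeneous D ∧ ∀ g : G, rename (φ g) p = p := Iff.rfl

/-- **A transversal of the `G`-orbits on the monomials of degree `D`**: a finite set of degree-`D`
monomials meeting every orbit of degree-`D` monomials exactly once (the print's `M_m(Y)`, the
lexicographically maximal monomial of each `Q`-orbit, is one such; AV p.29 L2108–2110).
[cite: MulmuleySohoniSIAM2001, §6 (AV p.29, all.txt L2108–2110)] -/
def IsTransversal (D : ℕ) (Λ : Finset (X →₀ ℕ)) : Prop :=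
  (∀ β ∈ Λ, β.degree = D) ∧
    (∀ α : X →₀ ℕ, α.degree = D → ∃ β ∈ Λ, β ∈ orbitFs φ α) ∧
      ∀ β₁ ∈ Λ, ∀ β₂ ∈ Λ, β₂ ∈ orbitFs φ β₁ → β₁ = β₂

variable {F}

/-- Coefficients of an orbit sum: `1` on the orbit, `0` elsewhere. [folklore] -/
private theorem coeff_orbitSum (α γ : X →₀ ℕ) :
    coeff γ (orbitSum φ F α) = if γ ∈ orbitFs φ α then 1 else 0 := by
  rw [orbitSum, coeff_sum]
  simp only [coeff_monomial]
  rw [Finset.sum_ite_eq']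

/-- An invariant polynomial has constant coefficients along orbits. [folklore] -/
private theorem coeff_eq_of_mem_orbitFs {p : MvPolynomial X F} (hp : IsInvariant φ F p)
    {α β : X →₀ ℕ} (h : β ∈ orbitFs φ α) : coeff β p = coeff α p := by
  obtain ⟨g, rfl⟩ := (mem_orbitFs φ).1 h
  conv_lhs => rw [← hp g]
  exact coeff_monAct_rename φ g α p

/-- Orbit sums are invariant. [folklore] -/
private theorem rename_orbitSum (g : G) (α : X →₀ ℕ) :
    rename (φ g) (orbitSum φ F α) = orbitSum φ F α := by
  classical
  rw [orbitSum, map_sum]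
  simp only [rename_monomial_eq]
  have hinj : Set.InjOn (monAct φ g) (orbitFs φ α : Set (X →₀ ℕ)) := by
    intro β₁ _ β₂ _ h
    have := congrArg (monAct φ g⁻¹) h
    rwa [monAct_inv_monAct, monAct_inv_monAct] at this
  have himage : (orbitFs φ α).image (monAct φ g) = orbitFs φ α := by
    ext γ
    simp only [Finset.mem_image]
    constructor
    · rintro ⟨β, hβ, rfl⟩
      exact monAct_mem_orbitFs φ hβ g
    · intro hγ
      exact ⟨monAct φ g⁻¹ γ, monAct_mem_orbitFs φ hγ g⁻¹, monAct_monAct_inv φ g γ⟩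
  calc ∑ β ∈ orbitFs φ α, (monomial (monAct φ g β) (1 : F) : MvPolynomial X F)
      = ∑ γ ∈ (orbitFs φ α).image (monAct φ g), monomial γ (1 : F) :=
        (Finset.sum_image (f := fun γ : X →₀ ℕ => (monomial γ (1 : F) : MvPolynomial X F))
          hinj).symm
    _ = ∑ γ ∈ orbitFs φ α, monomial γ (1 : F) := by rw [himage]

/-- **Orbit sums are invariant forms**: for `α` of degree `D`, the orbit sum of `α` lies in `V^G`.
[cite: MulmuleySohoniSIAM2001, Prop. 6.2 (AV p.29, all.txt L2112–2114)] -/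
theorem orbitSum_mem_invariantForms {D : ℕ} {α : X →₀ ℕ} (hα : α.degree = D) :
    orbitSum φ F α ∈ invariantForms φ F D := by
  refine ⟨?_, fun g => rename_orbitSum φ g α⟩
  rw [orbitSum]
  refine IsHomogeneous.sum _ _ _ fun β hβ => isHomogeneous_monomial _ ?_
  rw [degree_eq_of_mem_orbitFs φ hβ, hα]

/-- **Symmetrization versus orbit sum**: `α̂ = ∑_{σ∈G} σ(α) = |Stab_G(α)| · (orbit sum of α)` —
every member of the orbit is hit `|Stab_G(α)|` times. (So `α̂` is a NONZERO multiple of the orbit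
sum exactly when the stabilizer order is nonzero in `F`; cf. §4.)
[cite: MulmuleySohoniSIAM2001, §6 (AV p.29, all.txt L2110–2111)] -/
theorem symmetrize_monomial (α : X →₀ ℕ) :
    symmetrize φ F (monomial α 1) = stabCard φ α • orbitSum φ F α := by
  classical
  rw [symmetrize]
  simp only [rename_monomial_eq]
  rw [Finset.sum_comp (fun β : X →₀ ℕ => (monomial β (1 : F) : MvPolynomial X F))
    (fun g : G => monAct φ g α)]
  rw [show (Finset.univ.image fun g : G => monAct φ g α) = orbitFs φ α from rfl, orbitSum,
    Finset.smul_sum]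
  refine Finset.sum_congr rfl fun β hβ => ?_
  rw [card_filter_monAct_eq φ hβ]

/-- **An invariant form is the combination of the orbit sums of a transversal with its own
coefficients**: `p = ∑_{β ∈ Λ} (coeff_β p) · orbitSum β` for `p ∈ V^G`.
[cite: MulmuleySohoniSIAM2001, Prop. 6.2 (AV p.29, all.txt L2112–2114)] -/
theorem eq_sum_coeff_smul_orbitSum {D : ℕ} {Λ : Finset (X →₀ ℕ)} (hΛ : IsTransversal φ D Λ)
    {p : MvPolynomial X F} (hp : p ∈ invariantForms φ F D) :
    p = ∑ β ∈ Λ, coeff β p • orbitSum φ F β := by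
  classical
  obtain ⟨hdeg, hcov, huniq⟩ := hΛ
  obtain ⟨hhom, hinv⟩ := hp
  ext γ
  rw [coeff_sum]
  simp only [coeff_smul, coeff_orbitSum, smul_eq_mul, mul_ite, mul_one, mul_zero]
  by_cases hγ : γ.degree = D
  · obtain ⟨β₀, hβ₀Λ, hβ₀⟩ := hcov γ hγ
    have hγβ₀ : γ ∈ orbitFs φ β₀ := mem_orbitFs_comm φ hβ₀
    rw [Finset.sum_eq_single_of_mem β₀ hβ₀Λ]
    · rw [if_pos hγβ₀, coeff_eq_of_mem_orbitFs φ hinv hγβ₀]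
    · intro β hβΛ hne
      rw [if_neg]
      intro hγβ
      apply hne
      have h1 : orbitFs φ γ = orbitFs φ β := orbitFs_eq_of_mem φ hγβ
      have h2 : β₀ ∈ orbitFs φ β := h1 ▸ hβ₀
      exact (huniq β hβΛ β₀ hβ₀Λ h2)
  · rw [hhom.coeff_eq_zero hγ]
    symm
    refine Finset.sum_eq_zero fun β hβ => ?_
    rw [if_neg]
    intro hγβ
    exact hγ ((degree_eq_of_mem_orbitFs φ hγβ).trans (hdeg β hβ))

/-- **The orbit sums of a transversal span `V^G`.**
[cite: MulmuleySohoniSIAM2001, Prop. 6.2 (AV p.29, all.txt L2112–2114)] -/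
theorem span_orbitSum_eq {D : ℕ} {Λ : Finset (X →₀ ℕ)} (hΛ : IsTransversal φ D Λ) :
    Submodule.span F (Set.range fun β : Λ => orbitSum φ F (β : X →₀ ℕ)) =
      invariantForms φ F D := by
  apply le_antisymm
  · rw [Submodule.span_le]
    rintro _ ⟨⟨β, hβ⟩, rfl⟩
    exact orbitSum_mem_invariantForms φ (hΛ.1 β hβ)
  · intro p hp
    rw [eq_sum_coeff_smul_orbitSum φ hΛ hp]
    refine Submodule.sum_mem _ fun β hβ => Submodule.smul_mem _ _ ?_
    exact Submodule.subset_span ⟨⟨β, hβ⟩, rfl⟩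

/-- **The orbit sums of a transversal are linearly independent** (their supports are the
pairwise distinct orbits). [cite: MulmuleySohoniSIAM2001, Prop. 6.2 (AV p.29, all.txt L2112–2114)] -/
theorem linearIndependent_orbitSum {D : ℕ} {Λ : Finset (X →₀ ℕ)} (hΛ : IsTransversal φ D Λ) :
    LinearIndependent F (fun β : Λ => orbitSum φ F (β : X →₀ ℕ)) := by
  classical
  rw [Fintype.linearIndependent_iff]
  intro c hc i
  have h := congrArg (coeff (i : X →₀ ℕ)) hc
  rw [coeff_sum, coeff_zero] at h
  simp only [coeff_smul, coeff_orbitSum, smul_eq_mul, mul_ite, mul_one, mul_zero] at h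
  rw [Finset.sum_eq_single_of_mem i (Finset.mem_univ _)] at h
  · rwa [if_pos (self_mem_orbitFs φ _)] at h
  · intro i' _ hne
    rw [if_neg]
    intro hi
    exact hne (Subtype.ext (hΛ.2.2 _ i'.2 _ i.2 hi))

/-- **Orbit-sum basis theorem** (the characteristic-free content of Prop. 6.2): over every field,
the orbit sums of any transversal of the `G`-orbits on degree-`D` monomials form a basis of the
`G`-invariant forms of degree `D` (linearly independent and spanning).
[cite: MulmuleySohoniSIAM2001, Prop. 6.2 (AV p.29, all.txt L2112–2114)] -/
theorem orbitSum_basis {D : ℕ} {Λ : Finset (X →₀ ℕ)} (hΛ : IsTransversal φ D Λ) :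
    LinearIndependent F (fun β : Λ => orbitSum φ F (β : X →₀ ℕ)) ∧
      Submodule.span F (Set.range fun β : Λ => orbitSum φ F (β : X →₀ ℕ)) =
        invariantForms φ F D :=
  ⟨linearIndependent_orbitSum φ hΛ, span_orbitSum_eq φ hΛ⟩

/-- **Symmetrization basis theorem** (Prop. 6.2 in general form, with its exact hypothesis): if
the stabilizer orders `|Stab_G(β)|`, `β ∈ Λ`, are nonzero in `F` (e.g. `char F = 0`, or
`char F > |G|`), the symmetrizations `β̂ = ∑_{σ∈G} σ(β)` of a transversal `Λ` form a basis of
`V^G` (each `β̂` is a unit multiple of the orbit sum of `β`).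
[cite: MulmuleySohoniSIAM2001, Prop. 6.2 (AV p.29, all.txt L2112–2114)] -/
theorem symmetrize_basis_of_ne_zero {D : ℕ} {Λ : Finset (X →₀ ℕ)} (hΛ : IsTransversal φ D Λ)
    (hst : ∀ β ∈ Λ, (stabCard φ β : F) ≠ 0) :
    LinearIndependent F (fun β : Λ => symmetrize φ F (monomial (β : X →₀ ℕ) 1)) ∧
      Submodule.span F (Set.range fun β : Λ => symmetrize φ F (monomial (β : X →₀ ℕ) 1)) =
        invariantForms φ F D := by
  -- the symmetrizations are unit multiples of the orbit sums
  set w : Λ → Fˣ := fun β => Units.mk0 (stabCard φ (β : X →₀ ℕ) : F) (hst β β.2) with hw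
  have hfam : (fun β : Λ => symmetrize φ F (monomial (β : X →₀ ℕ) 1)) =
      w • fun β : Λ => orbitSum φ F (β : X →₀ ℕ) := by
    funext β
    simp only [Pi.smul_apply', hw, Units.smul_mk0, symmetrize_monomial, Nat.cast_smul_eq_nsmul]
  rw [hfam]
  refine ⟨(linearIndependent_orbitSum φ hΛ).units_smul w, ?_⟩
  rw [← span_orbitSum_eq φ (F := F) hΛ]
  apply le_antisymm
  · rw [Submodule.span_le]
    rintro _ ⟨β, rfl⟩
    simp only [Pi.smul_apply', Units.smul_def]
    exact Submodule.smul_mem _ _ (Submodule.subset_span ⟨β, rfl⟩)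
  · rw [Submodule.span_le]
    rintro _ ⟨β, rfl⟩
    have h : (fun β : Λ => orbitSum φ F (β : X →₀ ℕ)) β =
        ((w β)⁻¹ : Fˣ).val • (w • fun β : Λ => orbitSum φ F (β : X →₀ ℕ)) β := by
      simp only [Pi.smul_apply', Units.smul_def, smul_smul, Units.inv_mul, one_smul]
    rw [h]
    exact Submodule.smul_mem _ _ (Submodule.subset_span ⟨β, rfl⟩)

/-- **Transversals exist** (for a finite variable type): pick one monomial in each `G`-orbit of
degree-`D` monomials (the print picks the lexicographically largest).
[cite: MulmuleySohoniSIAM2001, §6 (AV p.29, all.txt L2108–2110)] -/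
theorem exists_isTransversal [Fintype X] (D : ℕ) : ∃ Λ : Finset (X →₀ ℕ), IsTransversal φ D Λ := by
  classical
  -- a choice of representative depending only on the orbit (as a finite set)
  let pick : Finset (X →₀ ℕ) → (X →₀ ℕ) := fun s => if h : s.Nonempty then h.choose else 0
  have pick_mem : ∀ s : Finset (X →₀ ℕ), s.Nonempty → pick s ∈ s := by
    intro s h
    simp only [pick, dif_pos h]
    exact h.choose_spec
  let rep : (X →₀ ℕ) → (X →₀ ℕ) := fun α => pick (orbitFs φ α)
  have rep_mem : ∀ α, rep α ∈ orbitFs φ α := fun α =>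
    pick_mem _ ⟨α, self_mem_orbitFs φ α⟩
  have rep_eq : ∀ {α β}, β ∈ orbitFs φ α → rep β = rep α := by
    intro α β h
    show pick (orbitFs φ β) = pick (orbitFs φ α)
    rw [orbitFs_eq_of_mem φ h]
  refine ⟨((Finset.univ : Finset X).finsuppAntidiag D).image rep, ?_, ?_, ?_⟩
  · intro β hβ
    obtain ⟨α, hα, rfl⟩ := Finset.mem_image.1 hβ
    rw [degree_eq_of_mem_orbitFs φ (rep_mem α), Finsupp.degree_eq_sum]
    exact (Finset.mem_finsuppAntidiag.1 hα).1
  · intro α hα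
    refine ⟨rep α, Finset.mem_image.2 ⟨α, ?_, rfl⟩, rep_mem α⟩
    rw [Finset.mem_finsuppAntidiag, ← Finsupp.degree_eq_sum]
    exact ⟨hα, Finset.subset_univ _⟩
  · intro β₁ hβ₁ β₂ hβ₂ h
    obtain ⟨α₁, -, rfl⟩ := Finset.mem_image.1 hβ₁
    obtain ⟨α₂, -, rfl⟩ := Finset.mem_image.1 hβ₂
    -- `rep α₂ ∈ orbit (rep α₁) = orbit α₁`, and `rep α₂ ∈ orbit α₂`; so the orbits agree
    have h1 : orbitFs φ (rep α₂) = orbitFs φ α₁ :=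
      (orbitFs_eq_of_mem φ h).trans (orbitFs_eq_of_mem φ (rep_mem α₁))
    have h2 : orbitFs φ (rep α₂) = orbitFs φ α₂ := orbitFs_eq_of_mem φ (rep_mem α₂)
    show pick (orbitFs φ α₁) = pick (orbitFs φ α₂)
    rw [← h1, h2]

end PermInvariants

end MS2001GenericCircuit

open MS2001GenericCircuit

/-! ## §3. Proposition 6.2 for the generic circuit form -/

section PropSixTwo

variable (F : Type u) [Field F] (k m : ℕ)

/-- **`H(Y)` is a `Q`-invariant form of degree `2^{k+1} - 1`**: `H(Y) ∈ V^Q` (`k ≥ 1`).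
[cite: MulmuleySohoniSIAM2001, §6 (AV p.29, all.txt L2076–2079, L2111–2114)] -/
theorem genericCircuitForm_mem_invariantForms (hk : 1 ≤ k) :
    genericCircuitForm F k m ∈ invariantForms (toPerm k m) F (2 ^ (k + 1) - 1) :=
  ⟨isHomogeneous_genericCircuitForm F k m hk, fun π => rename_toPerm_genericCircuitForm F π⟩

/-- **GCT I, Prop. 6.2, characteristic-free form (orbit sums)**: over EVERY field `F`, for the
generic circuit of depth `k` and width `m`, `V = Sym^D(Y)` with `D = 2^{k+1} - 1 = deg H(Y)` and
`Q` acting on `Y` (`toPerm`), the ORBIT SUMS of any transversal `Λ` of the `Q`-orbits on the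
monomials `M(Y)` of degree `D` form a basis of `V^Q` (linearly independent, spanning). This is the
statement that holds in all characteristics; the print's symmetrizations `α̂` are the multiples
`|Stab_Q(α)| ·` orbit sum (`symmetrize_monomial`).
[cite: MulmuleySohoniSIAM2001, Prop. 6.2 (AV p.29, all.txt L2112–2114)] -/
theorem MS2001_prop_6_2_orbitSum {Λ : Finset (Var k m →₀ ℕ)}
    (hΛ : IsTransversal (toPerm k m) (2 ^ (k + 1) - 1) Λ) :
    LinearIndependent F (fun β : Λ => orbitSum (toPerm k m) F (β : Var k m →₀ ℕ)) ∧
      Submodule.span F (Set.range fun β : Λ => orbitSum (toPerm k m) F (β : Var k m →₀ ℕ)) =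
        invariantForms (toPerm k m) F (2 ^ (k + 1) - 1) :=
  orbitSum_basis (toPerm k m) hΛ

/-- **GCT I, Prop. 6.2** (Mulmuley–Sohoni 2001, AV p.29, all.txt L2112–2114): "The set of forms
`α̂`, `α ∈ M_m(Y)`, is a basis of the space `V^Q` of `Q`-invariants in `V`" — `V` = forms in `Y`
of degree `D = deg H(Y) = 2^{k+1} - 1`, `Q` = the automorphisms of the generic circuit fixing the
inputs acting on `Y` (`CircuitAut`, `toPerm`), `α̂ = ∑_{σ∈Q} σ(α)` (`symmetrize`), `M_m(Y)` = the
(lexicographically) maximal monomial of each `Q`-orbit on the degree-`D` monomials — typed for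
EVERY transversal `Λ` of these orbits (`IsTransversal`; the lexicographic choice is one), "basis"
as (linearly independent) ∧ (span = `V^Q`). PROVED over every field of CHARACTERISTIC ZERO
(print: `F` algebraically closed of arbitrary characteristic — FALSE for `char F = p ≤ m`, `k ≥ 2`,
`MS2001_prop_6_2_false_of_charP`; the exact hypothesis is "all `|Stab_Q(α)|` nonzero in `F`",
`symmetrize_basis_of_ne_zero`; the characteristic-free statement is `MS2001_prop_6_2_orbitSum`).
[cite: MulmuleySohoniSIAM2001, Prop. 6.2 (AV p.29, all.txt L2112–2114)] -/
theorem MS2001_prop_6_2 [CharZero F] {Λ : Finset (Var k m →₀ ℕ)}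
    (hΛ : IsTransversal (toPerm k m) (2 ^ (k + 1) - 1) Λ) :
    LinearIndependent F
        (fun β : Λ => symmetrize (toPerm k m) F (monomial (β : Var k m →₀ ℕ) 1)) ∧
      Submodule.span F
          (Set.range fun β : Λ => symmetrize (toPerm k m) F (monomial (β : Var k m →₀ ℕ) 1)) =
        invariantForms (toPerm k m) F (2 ^ (k + 1) - 1) :=
  symmetrize_basis_of_ne_zero (toPerm k m) hΛ fun β _ =>
    Nat.cast_ne_zero.2 (stabCard_pos (toPerm k m) β).ne'

/-! ## §4. The characteristic-`p` erratum -/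

/-- The order of `Q`: `|Q| = (m!)^{k-1}`. [cite: MulmuleySohoniSIAM2001, §6 (AV p.29, all.txt L2080–2081)] -/
theorem MS2001GenericCircuit.card_circuitAut :
    Fintype.card (CircuitAut k m) = (Nat.factorial m) ^ (k - 1) := by
  change Fintype.card (Fin (k - 1) → Equiv.Perm (Fin m)) = _
  rw [Fintype.card_fun, Fintype.card_perm, Fintype.card_fin, Fintype.card_fin]

variable {k m}

/-- The monomial `y_u^D` of an input variable is fixed by `Q` (inputs are fixed). [folklore] -/
private theorem MS2001GenericCircuit.monAct_single_inl (π : CircuitAut k m) (u : Fin m) (D : ℕ) :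
    monAct (toPerm k m) π (Finsupp.single (Sum.inl u : Var k m) D) =
      Finsupp.single (Sum.inl u) D := by
  simp only [monAct, Finsupp.mapDomain_single, toPerm_apply, actVar]

/-- The monomial `y_u^D` lies in every transversal of the degree-`D` monomials (its orbit is a
singleton). [folklore] -/
private theorem MS2001GenericCircuit.single_inl_mem_of_isTransversal {D : ℕ}
    {Λ : Finset (Var k m →₀ ℕ)}
    (hΛ : IsTransversal (toPerm k m) D Λ) (u : Fin m) :
    Finsupp.single (Sum.inl u : Var k m) D ∈ Λ := by
  have hdeg : (Finsupp.single (Sum.inl u : Var k m) D).degree = D := Finsupp.degree_single _ _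
  obtain ⟨β, hβΛ, hβ⟩ := hΛ.2.1 _ hdeg
  obtain ⟨π, hπ⟩ := (mem_orbitFs (toPerm k m)).1 hβ
  rw [monAct_single_inl π u D] at hπ
  rw [hπ]
  exact hβΛ

/-- In characteristic `p ≤ m`, depth `k ≥ 2`, the symmetrization of `y_u^D` vanishes:
`∑_{σ∈Q} σ(y_u^D) = |Q| · y_u^D = (m!)^{k-1} · y_u^D = 0`. [folklore] -/
private theorem MS2001GenericCircuit.symmetrize_single_inl_eq_zero (p : ℕ) [Fact p.Prime] [CharP F p]
    (hpm : p ≤ m)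
    (hk : 2 ≤ k) (u : Fin m) (D : ℕ) :
    symmetrize (toPerm k m) F (monomial (Finsupp.single (Sum.inl u : Var k m) D) 1) = 0 := by
  have hp : p.Prime := Fact.out
  have hdvd : p ∣ (Nat.factorial m) ^ (k - 1) :=
    (Nat.dvd_factorial hp.pos hpm).trans (dvd_pow_self _ (by omega))
  rw [symmetrize_monomial,
    stabCard_eq_card_of_forall (toPerm k m) (fun π => monAct_single_inl π u D), card_circuitAut,
    ← Nat.cast_smul_eq_nsmul F, (CharP.cast_eq_zero_iff F p _).2 hdvd, zero_smul]

/-- **Prop. 6.2 is false as printed in characteristic `p ≤ m` (depth `k ≥ 2`).** Over a field `F`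
of characteristic `p` with `p ≤ m` and `k ≥ 2`, for EVERY transversal `Λ` of the `Q`-orbits on
the degree-`D` monomials (`D = 2^{k+1} - 1`), the family of symmetrizations `(α̂)_{α ∈ Λ}` is NOT
linearly independent — so it is not a basis of `V^Q`: the monomial `α₀ = y_u^D` of an input
variable is fixed by `Q`, hence lies in `Λ`, and `α̂₀ = |Q| · α₀ = (m!)^{k-1} · α₀ = 0` since
`p ∣ m!`. (The orbit-sum form `MS2001_prop_6_2_orbitSum` is the correct statement in all
characteristics; in characteristic `0` the print's statement holds, `MS2001_prop_6_2`.) Ours; the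
print states Prop. 6.2 over an algebraically closed field of arbitrary characteristic (AV p.28
L2000–2001) and uses `F_p`-versions of the set-up in §7.
[cite: MulmuleySohoniSIAM2001, Prop. 6.2 (AV p.29, all.txt L2112–2114)] -/
theorem MS2001_prop_6_2_false_of_charP (p : ℕ) [Fact p.Prime] [CharP F p] (hpm : p ≤ m)
    (hk : 2 ≤ k) {Λ : Finset (Var k m →₀ ℕ)}
    (hΛ : IsTransversal (toPerm k m) (2 ^ (k + 1) - 1) Λ) :
    ¬ LinearIndependent F
        (fun β : Λ => symmetrize (toPerm k m) F (monomial (β : Var k m →₀ ℕ) 1)) := by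
  have hm : 0 < m := lt_of_lt_of_le (Fact.out : p.Prime).pos hpm
  intro hli
  have hmem : Finsupp.single (Sum.inl ⟨0, hm⟩ : Var k m) (2 ^ (k + 1) - 1) ∈ Λ :=
    single_inl_mem_of_isTransversal hΛ ⟨0, hm⟩
  have hzero : symmetrize (toPerm k m) F
      (monomial (Finsupp.single (Sum.inl ⟨0, hm⟩ : Var k m) (2 ^ (k + 1) - 1)) 1) = 0 :=
    symmetrize_single_inl_eq_zero F p hpm hk ⟨0, hm⟩ _
  have hne := hli.ne_zero ⟨_, hmem⟩
  dsimp only at hne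
  exact hne hzero

/-- **Prop. 6.2 fails over the algebraically closed field `\overline{F_p}`** for `p ≤ m`, `k ≥ 2`
(the print's setting: "an algebraically closed field `F`", AV p.28 L2000), for every transversal.
[cite: MulmuleySohoniSIAM2001, Prop. 6.2 (AV p.29, all.txt L2112–2114)] -/
theorem MS2001_prop_6_2_false_algebraicClosure (p : ℕ) [Fact p.Prime] (hpm : p ≤ m) (hk : 2 ≤ k)
    {Λ : Finset (Var k m →₀ ℕ)} (hΛ : IsTransversal (toPerm k m) (2 ^ (k + 1) - 1) Λ) :
    ¬ LinearIndependent (AlgebraicClosure (ZMod p))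
        (fun β : Λ => symmetrize (toPerm k m) (AlgebraicClosure (ZMod p))
          (monomial (β : Var k m →₀ ℕ) 1)) :=
  MS2001_prop_6_2_false_of_charP (AlgebraicClosure (ZMod p)) p hpm hk hΛ

/-- **The erratum is not vacuous**: for every `p ≤ m`, `k ≥ 2` there IS a transversal, and for it
the printed basis statement fails over `\overline{F_p}` while the invariant space `V^Q` is
nonzero (it contains `H(Y)`). [cite: MulmuleySohoniSIAM2001, Prop. 6.2 (AV p.29, all.txt L2112–2114)] -/
theorem MS2001_prop_6_2_counterexample (p : ℕ) [Fact p.Prime] (hpm : p ≤ m) (hk : 2 ≤ k) :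
    ∃ Λ : Finset (Var k m →₀ ℕ), IsTransversal (toPerm k m) (2 ^ (k + 1) - 1) Λ ∧
      ¬ LinearIndependent (AlgebraicClosure (ZMod p))
          (fun β : Λ => symmetrize (toPerm k m) (AlgebraicClosure (ZMod p))
            (monomial (β : Var k m →₀ ℕ) 1)) ∧
        genericCircuitForm (AlgebraicClosure (ZMod p)) k m ∈
          invariantForms (toPerm k m) (AlgebraicClosure (ZMod p)) (2 ^ (k + 1) - 1) := by
  obtain ⟨Λ, hΛ⟩ := exists_isTransversal (toPerm k m) (2 ^ (k + 1) - 1)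
  exact ⟨Λ, hΛ, MS2001_prop_6_2_false_algebraicClosure p hpm hk hΛ,
    genericCircuitForm_mem_invariantForms _ k m (by omega)⟩

end PropSixTwo

/-! ## §5. `H(Y)` is not the unique `Q`-invariant form (AV p.29 L2116–2117) -/

section NotUnique

variable (F : Type u) [Field F] {k m : ℕ}

/-- The pure power `y_u^D` of an input variable has coefficient `0` in `H(Y)` (every monomial of
`H(Y)` contains a root variable `y^{root}_{v,w}`). [folklore] -/
private theorem MS2001GenericCircuit.coeff_single_inl_genericCircuitForm (u : Fin m) (D : ℕ) :
    coeff (Finsupp.single (Sum.inl u : Var k m) D) (genericCircuitForm F k m) = 0 := by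
  classical
  rw [genericCircuitForm, coeff_sum]
  refine Finset.sum_eq_zero fun v _ => ?_
  rw [coeff_sum]
  refine Finset.sum_eq_zero fun w _ => ?_
  rw [coeff_X_mul']
  have hnot : (Sum.inr (Sum.inl (v, w)) : Var k m) ∉
      (Finsupp.single (Sum.inl u : Var k m) D).support := by
    intro h
    have h' := Finsupp.support_single_subset h
    simp at h'
  rw [if_neg hnot]

/-- **"Unlike the determinant (cf. Proposition 4.2), `H(Y)` is not a unique form stabilized by
`Q`"** (AV p.29 L2116–2117): for width `m ≥ 1` the space `V^Q` of `Q`-invariant forms of degree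
`deg H(Y) = 2^{k+1} - 1` contains a form that is NOT a scalar multiple of `H(Y)` — e.g. the
`Q`-fixed monomial `y_u^D` of an input variable (contrast: `V^R = F · det(Y)` for the determinant
and its stabilizer `R`, Prop. 4.2 / `MS2001_prop_4_2_holds`).
[cite: MulmuleySohoniSIAM2001, §6 (AV p.29, all.txt L2116–2117)] -/
theorem MS2001_genericCircuitForm_not_unique_invariant (hm : 1 ≤ m) :
    ∃ g ∈ invariantForms (toPerm k m) F (2 ^ (k + 1) - 1),
      ∀ c : F, g ≠ c • genericCircuitForm F k m := by
  refine ⟨monomial (Finsupp.single (Sum.inl ⟨0, hm⟩ : Var k m) (2 ^ (k + 1) - 1)) 1,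
    ⟨?_, ?_⟩, ?_⟩
  · exact isHomogeneous_monomial _ (Finsupp.degree_single _ _)
  · intro π
    rw [rename_monomial_eq (toPerm k m), monAct_single_inl]
  · intro c h
    have h1 := congrArg (coeff (Finsupp.single (Sum.inl ⟨0, hm⟩ : Var k m) (2 ^ (k + 1) - 1))) h
    rw [coeff_monomial, if_pos rfl, coeff_smul, coeff_single_inl_genericCircuitForm,
      smul_zero] at h1
    exact one_ne_zero h1

end NotUnique

end Literature.Computability.AlgebraicComplexity
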